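import Summits.KontsevichZagierPeriods.KontsevichZagierPeriods.Theorems.TerasomaMultiplicationDasGapTwelveStubInvolutionQuotientAux
import Literature.NumberTheory.Transcendental.KZGroundingRelations
import Literature.NumberTheory.Transcendental.EllIterRep
import Summits.KontsevichZagierPeriods.KontsevichZagierPeriods.Theorems.HermiteRigidityGenusTwoCycleTransferPushforwardDimOne
import Summits.KontsevichZagierPeriods.KontsevichZagierPeriods.Theorems.HermiteRigidityGenusTwoCycleTransferSemialgebraicInvFunOn

/-!
# `DasGapTwelve` (stmt-KontsevichZagierPeriods-13215), line `picard-involution-quotient`,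
stub `stub_involutionQuotient` — the quotient step as moves

The registered stub `stub_involutionQuotient` of the crux `DasGapTwelve` (route
TerasomaMultiplication): for the pinned representation
`ρ₂ = [(0,1), √3 (t + (1+√3)/2)(t − t⁴)^(−3/4)]` (the `τ₊`-anti-invariant form of the Picard curve
`v⁴ = t − t⁴` on its real arc) there is a representation
`ρ₃ = [(√D, ∞), 2√3(√3+1)(x³ − D x)^(−1/2)]`, `D = 3 + 2√3` (twice the invariant differential on the
unbounded real component of the quotient elliptic curve `V² = x³ − D x`), and `ρ₂ ~ ρ₃` for every
pinned `ρ₃`.  Moves: rule 1a splits the arc at `t⋆ = (√3−1)/2` (a null point); each cell is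
pushed forward along the quotient map `𝐰(t) = √((1+t+t²)/(t(1−t)))` — ONE instance of
Kontsevich–Zagier's rule (2) each (`stub_pushforwardDimOne`, inverse by
`stub_semialgebraicInvFunOn`, weight identity `stub_quotientWeight` of the Aux file) — onto `(√D, ∞)` with
integrand `√3(√3+1)(x³ − D x)^(−1/2)`; rule 1b adds the two sheets.

References: M. Kontsevich, D. Zagier, *Periods* (2001), §1.2 rules (1), (2); J. Bochnak,
M. Coste, M.-F. Roy, *Real Algebraic Geometry* (1998), §2.2.
-/

noncomputable section

open Set
open Literature.NumberTheory.Transcendental Literature.ModelTheory.ExponentialFields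

/-! ### The moves of the quotient step -/

namespace Summit.KontsevichZagierPeriods.TerasomaMultiplication.DasGapTwelve

open MeasureTheory
open Summit.KontsevichZagierPeriods.HermiteRigidity.GenusTwoCycleTransfer
  (stub_pushforwardDimOne stub_semialgebraicInvFunOn)

/-- **One cell.** For the pinned `ρ₂ = [(0,1), √3 (t + (1+√3)/2)(t − t⁴)^(−3/4)]` and a cell
`J ⊆ (0,1) ∖ {t⋆}` on which `𝐰` is injective and attains every level `x > √D`, the rule-2
push-forward of `ρ₂|J` along `𝐰` is a representation on `(√D, ∞)` with integrand
`√3 (√3+1)(x³ − D x)^(−1/2)` there (`stub_pushforwardDimOne` + `stub_semialgebraicInvFunOn`;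
the weight is `stub_quotientWeight`). [cite: KontsevichZagier2001, §1.2 rule (2)] -/
theorem cell_pushforward {J : Set ℝ} (hJsub : J ⊆ Ioo (0:ℝ) 1)
    (hJne : ∀ t ∈ J, t ≠ (Real.sqrt 3 - 1) / 2)
    (hinj : InjOn (fun t : ℝ => Real.sqrt ((1 + t + t ^ 2) / (t * (1 - t)))) J)
    (hsurj : ∀ x, Real.sqrt (3 + 2 * Real.sqrt 3) < x →
      ∃ t ∈ J, Real.sqrt ((1 + t + t ^ 2) / (t * (1 - t))) = x)
    (hJsa : IsSemialgebraic ℚ {p : Fin 1 → ℝ | p 0 ∈ J})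
    (ρ₂ : KZ.IntegralRep 1)
    (hi : Set.EqOn ρ₂.integrand (fun x => Real.sqrt 3 * (x 0 + (1 + Real.sqrt 3) / 2) *
      (x 0 - (x 0) ^ 4) ^ (-(3:ℝ)/4)) ρ₂.domain)
    (hsub : {p : Fin 1 → ℝ | p 0 ∈ J} ⊆ ρ₂.domain) :
    ∃ s : KZ.IntegralRep 1, s.domain = {q | Real.sqrt (3 + 2 * Real.sqrt 3) < q 0} ∧
      Set.EqOn s.integrand (fun q => Real.sqrt 3 * (Real.sqrt 3 + 1) *
        ((q 0) ^ 3 - (3 + 2 * Real.sqrt 3) * q 0) ^ (-(1:ℝ)/2)) s.domain ∧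
      KZ.of (ρ₂.restrict {p | p 0 ∈ J} hJsa hsub) - KZ.of s ∈ KZ.changeOfVariablesRel := by
  set r : KZ.IntegralRep 1 := ρ₂.restrict {p | p 0 ∈ J} hJsa hsub with hr_def
  have hrd : r.domain = {p | p 0 ∈ J} := rfl
  have hmem : ∀ p : Fin 1 → ℝ, p ∈ r.domain ↔ p 0 ∈ J := fun p => Iff.rfl
  have hDσ : ∀ p ∈ r.domain, p 0 * (1 - p 0) ≠ 0 := fun p hp =>
    (signs (p 0) (hJsub ((hmem p).1 hp))).2.1.ne'
  have hρσ : ∀ p ∈ r.domain, 0 < (1 + p 0 + (p 0) ^ 2) / (p 0 * (1 - p 0)) := fun p hp =>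
    (signs (p 0) (hJsub ((hmem p).1 hp))).2.2
  -- `𝐰`, `𝐰′` are ℚ-semialgebraic on the cell, `𝐰′` is the derivative of `𝐰` and never vanishes
  have hφ := w_semialgebraic hJsa hDσ
  have hφ' := w'_semialgebraic hJsa hDσ hρσ
  have hder := fun p (hp : p ∈ r.domain) => hasDerivAt_w (p 0) (hJsub ((hmem p).1 hp))
  have hne := fun p (hp : p ∈ r.domain) =>
    w'_ne_zero (p 0) (hJsub ((hmem p).1 hp)) (hJne _ ((hmem p).1 hp))
  -- `p ↦ (𝐰 (p 0))` is injective on the cell, with semialgebraic inverse on the image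
  set Φ : (Fin 1 → ℝ) → (Fin 1 → ℝ) :=
    fun p _ => Real.sqrt ((1 + p 0 + (p 0) ^ 2) / (p 0 * (1 - p 0))) with hΦ_def
  have hΦsa : IsSemialgebraicMapOn ℚ r.domain Φ := IsSemialgebraicMapOn.of_forall hJsa fun _ => hφ
  have hΦinj : InjOn Φ r.domain := by
    intro p hp p' hp' h
    have h0 := hinj ((hmem p).1 hp) ((hmem p').1 hp') (congrFun h 0)
    funext i
    rw [Fin.fin_one_eq_zero i]
    exact h0
  have hG : IsSemialgebraicMapOn ℚ (Φ '' r.domain) (Function.invFunOn Φ r.domain) :=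
    stub_semialgebraicInvFunOn hΦsa hΦinj
  have hGφ : ∀ p ∈ r.domain, Function.invFunOn Φ r.domain (Φ p) = p := fun p hp =>
    hΦinj.leftInvOn_invFunOn hp
  -- the rule-2 push-forward
  obtain ⟨s, hsd, hsi, hrel⟩ := stub_pushforwardDimOne r
    (fun y => Real.sqrt ((1 + y + y ^ 2) / (y * (1 - y))))
    (fun y => (2 * y ^ 2 + 2 * y - 1) / (y * (1 - y)) ^ 2 /
      (2 * Real.sqrt ((1 + y + y ^ 2) / (y * (1 - y)))))
    (Function.invFunOn Φ r.domain) hφ hφ' hder hne hG hGφ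
  -- its domain is `(√D, ∞)`
  have himage : Φ '' r.domain = {q | Real.sqrt (3 + 2 * Real.sqrt 3) < q 0} := by
    ext q
    constructor
    · rintro ⟨p, hp, rfl⟩
      exact sqrtD_lt_w (p 0) (hJsub ((hmem p).1 hp)) (hJne _ ((hmem p).1 hp))
    · intro hq
      obtain ⟨t, ht, htq⟩ := hsurj (q 0) hq
      refine ⟨fun _ => t, (hmem _).2 ht, ?_⟩
      funext i
      rw [Fin.fin_one_eq_zero i]
      exact htq
  refine ⟨s, hsd.trans himage, fun q hq => ?_, hrel⟩
  -- and its integrand at `x = 𝐰 t` is the weight `f₂(t)/|𝐰′(t)| = √3(√3+1)(x³ − Dx)^(−1/2)`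
  rw [hsd] at hq
  obtain ⟨p, hp, rfl⟩ := hq
  have hp' : p 0 ∈ Ioo (0:ℝ) 1 := hJsub ((hmem p).1 hp)
  have h1 := hsi p hp
  rw [h1, show r.integrand = ρ₂.integrand from rfl, hi (hsub hp)]
  exact stub_quotientWeight (p 0) hp' (hJne _ ((hmem p).1 hp))

/-- Stub Q (HARDEST; quotient by the companion involution `τ₋`): with `D = 3 + 2√3` and
`w(t) = √((1+t+t²)/(t(1−t)))`, which maps each of `(0,t*)`, `(t*,1)` monotonically onto `(√D, ∞)` with
`(t + (1+√3)/2)(t−t⁴)^(−3/4) = (√3+1)·|w′(t)|·(w³ − D w)^(−1/2)`, two rule-2 moves and rule 1a/1b give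
`[(0,1), √3(t + (1+√3)/2)(t−t⁴)^(−3/4)] ~ [(√D,∞), 2√3(√3+1)(x³ − D x)^(−1/2)]`. [folklore] -/
theorem stub_involutionQuotient :
    ∀ (ρ₂ : Literature.NumberTheory.Transcendental.KZ.IntegralRep 1), ρ₂.domain = {x | x 0 ∈ Set.Ioo (0:ℝ) 1} → Set.EqOn ρ₂.integrand (fun x => Real.sqrt 3 * (x 0 + (1 + Real.sqrt 3) / 2) * (x 0 - (x 0) ^ 4) ^ (-(3:ℝ)/4)) ρ₂.domain → (∃ ρ₃ : Literature.NumberTheory.Transcendental.KZ.IntegralRep 1, ρ₃.domain = {x | Real.sqrt (3 + 2 * Real.sqrt 3) < x 0} ∧ Set.EqOn ρ₃.integrand (fun x => 2 * Real.sqrt 3 * (Real.sqrt 3 + 1) * ((x 0) ^ 3 - (3 + 2 * Real.sqrt 3) * x 0) ^ (-(1:ℝ)/2)) ρ₃.domain) ∧ ∀ (ρ₃ : Literature.NumberTheory.Transcendental.KZ.IntegralRep 1), ρ₃.domain = {x | Real.sqrt (3 + 2 * Real.sqrt 3) < x 0} → Set.EqOn ρ₃.integrand (fun x => 2 * Real.sqrt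 3 * (Real.sqrt 3 + 1) * ((x 0) ^ 3 - (3 + 2 * Real.sqrt 3) * x 0) ^ (-(1:ℝ)/2)) ρ₃.domain → Literature.NumberTheory.Transcendental.KZ.Equivalent ρ₂ ρ₃ := by
  intro ρ₂ hd hi
  -- the two cells `A = (0, t⋆)`, `B = (t⋆, 1)` of the arc
  have hA : IsSemialgebraic ℚ {p : Fin 1 → ℝ | p 0 ∈ Ioo (0:ℝ) ((Real.sqrt 3 - 1) / 2)} := by
    have h := (KZ.isSemialgebraic_setOf_const_lt_apply (isAlgebraic_zero) (0 : Fin 1)).inter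
      (KZ.isSemialgebraic_setOf_apply_lt_const isAlgebraic_tstar (0 : Fin 1))
    convert h using 1
    ext p
    simp only [mem_setOf_eq, mem_Ioo, mem_inter_iff]
  have hB : IsSemialgebraic ℚ {p : Fin 1 → ℝ | p 0 ∈ Ioo ((Real.sqrt 3 - 1) / 2) (1:ℝ)} := by
    have h := (KZ.isSemialgebraic_setOf_const_lt_apply isAlgebraic_tstar (0 : Fin 1)).inter
      (KZ.isSemialgebraic_setOf_apply_lt_const (isAlgebraic_one) (0 : Fin 1))
    convert h using 1
    ext p
    simp only [mem_setOf_eq, mem_Ioo, mem_inter_iff]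
  have hAsub : {p : Fin 1 → ℝ | p 0 ∈ Ioo (0:ℝ) ((Real.sqrt 3 - 1) / 2)} ⊆ ρ₂.domain := by
    rw [hd]; exact fun p hp => ⟨hp.1, hp.2.trans tstar_lt_one⟩
  have hBsub : {p : Fin 1 → ℝ | p 0 ∈ Ioo ((Real.sqrt 3 - 1) / 2) (1:ℝ)} ⊆ ρ₂.domain := by
    rw [hd]; exact fun p hp => ⟨tstar_pos.trans hp.1, hp.2⟩
  -- two rule-2 moves
  obtain ⟨sA, hsAd, hsAi, hArel⟩ := cell_pushforward (J := Ioo (0:ℝ) ((Real.sqrt 3 - 1) / 2))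
    (fun t ht => ⟨ht.1, ht.2.trans tstar_lt_one⟩) (fun t ht => ht.2.ne) w_injOn_left
    (fun x hx => by
      obtain ⟨t₁, t₂, h₁, -, e₁, -⟩ := exists_preimages x hx
      exact ⟨t₁, h₁, e₁⟩) hA ρ₂ hi hAsub
  obtain ⟨sB, hsBd, hsBi, hBrel⟩ := cell_pushforward (J := Ioo ((Real.sqrt 3 - 1) / 2) (1:ℝ))
    (fun t ht => ⟨tstar_pos.trans ht.1, ht.2⟩) (fun t ht => ht.1.ne') w_injOn_right
    (fun x hx => by
      obtain ⟨t₁, t₂, -, h₂, -, e₂⟩ := exists_preimages x hx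
      exact ⟨t₂, h₂, e₂⟩) hB ρ₂ hi hBsub
  refine ⟨⟨⟨sA.domain, fun q => 2 * sA.integrand q, sA.isSemialgebraic_domain,
      (isSemialgebraicFunOn_const_ofNat sA.isSemialgebraic_domain 2).fun_mul
        sA.isSemialgebraicFunOn_integrand, sA.integrableOn.const_mul 2⟩, hsAd, ?_⟩, ?_⟩
  · -- existence: twice the push-forward of one cell
    intro q hq
    show 2 * sA.integrand q = _
    rw [hsAi hq]
    ring
  -- equivalence with any pinned `ρ₃`
  intro ρ₃ hd₃ hi₃
  -- rule 1a: `[ρ₂] ≡ [ρ₂|A] + [ρ₂|B]` (the point `t⋆` is null)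
  have hE : IsSemialgebraic ℚ ({p : Fin 1 → ℝ | p 0 ∈ Ioo (0:ℝ) ((Real.sqrt 3 - 1) / 2)} ∪
      {p : Fin 1 → ℝ | p 0 ∈ Ioo ((Real.sqrt 3 - 1) / 2) (1:ℝ)}) := hA.union hB
  have hEsub : ({p : Fin 1 → ℝ | p 0 ∈ Ioo (0:ℝ) ((Real.sqrt 3 - 1) / 2)} ∪
      {p : Fin 1 → ℝ | p 0 ∈ Ioo ((Real.sqrt 3 - 1) / 2) (1:ℝ)}) ⊆ ρ₂.domain :=
    union_subset hAsub hBsub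
  have hnull : volume (ρ₂.domain \ ({p : Fin 1 → ℝ | p 0 ∈ Ioo (0:ℝ) ((Real.sqrt 3 - 1) / 2)} ∪
      {p : Fin 1 → ℝ | p 0 ∈ Ioo ((Real.sqrt 3 - 1) / 2) (1:ℝ)})) = 0 := by
    refine measure_mono_null (fun p hp => ?_) (KZ.volume_setOf_last_eq_zero (n := 0)
      ((Real.sqrt 3 - 1) / 2))
    rw [hd] at hp
    obtain ⟨hp, hp'⟩ := hp
    simp only [mem_union, mem_setOf_eq, mem_Ioo, not_or, not_and, not_lt] at hp'
    show p 0 = (Real.sqrt 3 - 1) / 2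
    have h1 := hp'.1 hp.1
    rcases h1.lt_or_eq with h | h
    · exact absurd hp.2 (not_lt.mpr (hp'.2 h))
    · exact h.symm
  have e0 := ρ₂.of_sub_of_restrict_mem_relations hE hEsub hnull
  have e1 : KZ.of (ρ₂.restrict _ hE hEsub) -
      KZ.of (ρ₂.restrict {p | p 0 ∈ Ioo (0:ℝ) ((Real.sqrt 3 - 1) / 2)} hA hAsub) -
      KZ.of (ρ₂.restrict {p | p 0 ∈ Ioo ((Real.sqrt 3 - 1) / 2) (1:ℝ)} hB hBsub) ∈
        KZ.domainAddRel := by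
    refine ⟨1, ρ₂.restrict _ hE hEsub,
      ρ₂.restrict {p | p 0 ∈ Ioo (0:ℝ) ((Real.sqrt 3 - 1) / 2)} hA hAsub,
      ρ₂.restrict {p | p 0 ∈ Ioo ((Real.sqrt 3 - 1) / 2) (1:ℝ)} hB hBsub, rfl, ?_,
      fun _ _ => rfl, fun _ _ => rfl, rfl⟩
    rw [show (ρ₂.restrict {p | p 0 ∈ Ioo (0:ℝ) ((Real.sqrt 3 - 1) / 2)} hA hAsub).domain ∩
        (ρ₂.restrict {p | p 0 ∈ Ioo ((Real.sqrt 3 - 1) / 2) (1:ℝ)} hB hBsub).domain = ∅ from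
      eq_empty_of_forall_notMem fun p hp => (lt_asymm hp.1.2 hp.2.1).elim, measure_empty]
  -- rule 1b: `[ρ₃] ≡ [sA] + [sB]`
  have e2 : KZ.of ρ₃ - KZ.of sA - KZ.of sB ∈ KZ.integrandAddRel := by
    refine ⟨1, ρ₃, sA, sB, hsAd.trans hd₃.symm, hsBd.trans hd₃.symm, fun q hq => ?_, rfl⟩
    rw [Pi.add_apply, hi₃ hq, hsAi (by rw [hsAd, ← hd₃]; exact hq),
      hsBi (by rw [hsBd, ← hd₃]; exact hq)]
    ring
  have h0 := e0
  have h1 := KZ.domainAddRel_subset_relations e1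
  have h2 := KZ.integrandAddRel_subset_relations e2
  have h3 := KZ.changeOfVariablesRel_subset_relations hArel
  have h4 := KZ.changeOfVariablesRel_subset_relations hBrel
  show KZ.of ρ₂ - KZ.of ρ₃ ∈ KZ.relations
  have : KZ.of ρ₂ - KZ.of ρ₃ = (KZ.of ρ₂ - KZ.of (ρ₂.restrict _ hE hEsub)) +
      (KZ.of (ρ₂.restrict _ hE hEsub) -
        KZ.of (ρ₂.restrict {p | p 0 ∈ Ioo (0:ℝ) ((Real.sqrt 3 - 1) / 2)} hA hAsub) -
        KZ.of (ρ₂.restrict {p | p 0 ∈ Ioo ((Real.sqrt 3 - 1) / 2) (1:ℝ)} hB hBsub)) +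
      (KZ.of (ρ₂.restrict {p | p 0 ∈ Ioo (0:ℝ) ((Real.sqrt 3 - 1) / 2)} hA hAsub) - KZ.of sA) +
      (KZ.of (ρ₂.restrict {p | p 0 ∈ Ioo ((Real.sqrt 3 - 1) / 2) (1:ℝ)} hB hBsub) - KZ.of sB) -
      (KZ.of ρ₃ - KZ.of sA - KZ.of sB) := by abel
  rw [this]
  exact KZ.relations.sub_mem (KZ.relations.add_mem (KZ.relations.add_mem
    (KZ.relations.add_mem h0 h1) h3) h4) h2

end Summit.KontsevichZagierPeriods.TerasomaMultiplication.DasGapTwelve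

end
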